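import Summits.CriticalPhenomena.CardyFormulaZ2.Theses.CardyIKTransport
import Summits.CriticalPhenomena.CardyFormulaZ2.Theorems.IKMixedBoxCrossing.Negative.IKMixedBoxCrossingNoFKG

/-!
# `IKMixedBoxCrossing` (crux stmt-CriticalPhenomena-5911): the bond field is NOT positively associated

Negative-side support lemma from the standing disprover (refuter, cdisprove lane); continues
`IKMixedBoxCrossingSmallModels` / `IKMixedBoxCrossingNoFKG` (same namespace). Crossing events are
increasing events of the random bond configuration `edges S ω`; its law violates Harris–FKG on every
`S`-column face because each face carries exactly ONE diagonal: the two diagonal bonds are each open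
with probability `1/8` but never simultaneously. Nothing here asserts a Theses decl positively.
-/

namespace Summit.CriticalPhenomena.CardyFormulaZ2.Theorems.IKMixedBoxCrossing.Negative

open scoped Classical ENNReal
open MeasureTheory ProbabilityTheory unitInterval
open Literature.Probability.Percolation Literature.Probability.LatticeModels
open Summit.CriticalPhenomena.CardyFormulaZ2.Theses.CardyIKTransport (IKMixedBoxCrossing)

noncomputable section


/-- main diagonal bond of the origin face present, in bit form (`0 ∈ S`): both endpoints black and
the coin says "main". -/
def Dmain : Set Ω := {ω | (Xor (0 ∈ ω.1) (0 ∈ ω.2.1) ∧ Xor (1 ∈ ω.1) (Xor (1 ∈ ω.2.1) (![0, 0] ∈ ω.2.2.1))) ∧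
  ![0, 0] ∉ ω.2.2.2.2}
/-- anti-diagonal bond of the origin face present, in bit form (`0 ∈ S`). -/
def Danti : Set Ω := {ω | (Xor (0 ∈ ω.1) (1 ∈ ω.2.1) ∧ Xor (1 ∈ ω.1) (0 ∈ ω.2.1)) ∧ ![0, 0] ∈ ω.2.2.2.2}

/-- Coordinate measurability: the diagonal coin of the origin face. [folklore] -/
theorem measurable_C00 : Measurable fun ω : Ω => ![0, 0] ∈ ω.2.2.2.2 :=
  (measurable_set_mem _).comp (measurable_snd.comp (measurable_snd.comp (measurable_snd.comp measurable_snd)))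

/-- `Dmain` is measurable. [folklore] -/
theorem measurableSet_Dmain : MeasurableSet Dmain :=
  measurableSet_setOf.2 (((measurable_xor measurable_A0 measurable_B0).and
    (measurable_xor measurable_A1 (measurable_xor measurable_B1 measurable_P00))).and measurable_C00.not)

/-- `Danti` is measurable. [folklore] -/
theorem measurableSet_Danti : MeasurableSet Danti :=
  measurableSet_setOf.2 (((measurable_xor measurable_A0 measurable_B1).and
    (measurable_xor measurable_A1 measurable_B0)).and measurable_C00)

/-- the coin cylinder of the hidden bits -/
theorem ν_coin_not : ν {y : Rest | ![0, 0] ∉ y.2.2.2} = 2⁻¹ := by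
  have : {y : Rest | ![0, 0] ∉ y.2.2.2} = (Set.univ : Set (Set ℤ)) ×ˢ ((Set.univ : Set (Set (Site 2))) ×ˢ
      ((Set.univ : Set (Set (Site 2))) ×ˢ {C : Set (Site 2) | ![0, 0] ∉ C})) := by
    ext y; simp
  rw [this, ν, Measure.prod_prod, Measure.prod_prod, Measure.prod_prod, measure_univ, measure_univ, measure_univ,
    one_mul, one_mul, one_mul, sitePercolation, setBernoulli_apply']
  have h2 : (fun p : Site 2 → Prop ↦ {i | p i}) ⁻¹' {C : Set (Site 2) | ![0, 0] ∉ C}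
      = Set.pi (({![0, 0]} : Finset (Site 2)) : Set (Site 2)) (fun _ => {q : Prop | ¬ q}) := by
    ext g; simp
  rw [h2, Measure.infinitePi_pi _ (fun _ _ => MeasurableSpace.measurableSet_top), Finset.prod_singleton]
  simp [Set.indicator, symm_half, coe_toNNReal_half]

/-- Hidden bits: the origin coin says "anti" with probability `1/2`. [folklore] -/
theorem ν_coin_mem : ν {y : Rest | ![0, 0] ∈ y.2.2.2} = 2⁻¹ := by
  have : {y : Rest | ![0, 0] ∈ y.2.2.2} = (Set.univ : Set (Set ℤ)) ×ˢ ((Set.univ : Set (Set (Site 2))) ×ˢ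
      ((Set.univ : Set (Set (Site 2))) ×ˢ {C : Set (Site 2) | ![0, 0] ∈ C})) := by
    ext y; simp
  rw [this, ν, Measure.prod_prod, Measure.prod_prod, Measure.prod_prod, measure_univ, measure_univ, measure_univ,
    one_mul, one_mul, one_mul, sitePercolation, setBernoulli_apply']
  have h2 : (fun p : Site 2 → Prop ↦ {i | p i}) ⁻¹' {C : Set (Site 2) | ![0, 0] ∈ C}
      = Set.pi (({![0, 0]} : Finset (Site 2)) : Set (Site 2)) (fun _ => {q : Prop | q}) := by
    ext g; simp
  rw [h2, Measure.infinitePi_pi _ (fun _ _ => MeasurableSpace.measurableSet_top), Finset.prod_singleton]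
  simp [Set.indicator, coe_toNNReal_half]

/-- The `A`-slice of `Dmain` has mass `1/4` when the coin says "main", else `0`. [folklore] -/
theorem slice_Dmain (y : Rest) :
    sitePercolation ℤ half ((fun A : Set ℤ => (A, y)) ⁻¹' Dmain) =
      {y : Rest | ![0, 0] ∉ y.2.2.2}.indicator (fun _ => (4⁻¹ : ℝ≥0∞)) y := by
  by_cases h : ![0, 0] ∈ y.2.2.2
  · rw [Set.indicator_of_notMem (by simpa using h)]
    have : (fun A : Set ℤ => (A, y)) ⁻¹' Dmain = ∅ := by
      ext A; simp [Dmain, h]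
    rw [this, measure_empty]
  · rw [Set.indicator_of_mem (by simpa using h)]
    have : (fun A : Set ℤ => (A, y)) ⁻¹' Dmain =
        {A : Set ℤ | (0 ∈ A ↔ ¬ (0 ∈ y.1)) ∧ (1 ∈ A ↔ ¬ Xor (1 ∈ y.1) (![0, 0] ∈ y.2.1))} := by
      ext A; simp only [Dmain, Xor, Set.mem_preimage, Set.mem_setOf_eq, h, not_false_eq_true, and_true]; tauto
    rw [this, μA_two']

/-- The `A`-slice of `Danti` has mass `1/4` when the coin says "anti", else `0`. [folklore] -/
theorem slice_Danti (y : Rest) :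
    sitePercolation ℤ half ((fun A : Set ℤ => (A, y)) ⁻¹' Danti) =
      {y : Rest | ![0, 0] ∈ y.2.2.2}.indicator (fun _ => (4⁻¹ : ℝ≥0∞)) y := by
  by_cases h : ![0, 0] ∈ y.2.2.2
  · rw [Set.indicator_of_mem (by simpa using h)]
    have : (fun A : Set ℤ => (A, y)) ⁻¹' Danti =
        {A : Set ℤ | (0 ∈ A ↔ ¬ (1 ∈ y.1)) ∧ (1 ∈ A ↔ ¬ (0 ∈ y.1))} := by
      ext A; simp only [Danti, Xor, Set.mem_preimage, Set.mem_setOf_eq, h, and_true]; tauto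
    rw [this, μA_two']
  · rw [Set.indicator_of_notMem (by simpa using h)]
    have : (fun A : Set ℤ => (A, y)) ⁻¹' Danti = ∅ := by
      ext A; simp [Danti, h]
    rw [this, measure_empty]

/-- The coin cylinder `{coin = main}` is measurable. [folklore] -/
theorem measurableSet_coin_not : MeasurableSet {y : Rest | ![0, 0] ∉ y.2.2.2} :=
  measurableSet_setOf.2 ((measurable_set_mem _).comp (measurable_snd.comp (measurable_snd.comp measurable_snd))).not

/-- The coin cylinder `{coin = anti}` is measurable. [folklore] -/
theorem measurableSet_coin_mem : MeasurableSet {y : Rest | ![0, 0] ∈ y.2.2.2} :=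
  measurableSet_setOf.2 ((measurable_set_mem _).comp (measurable_snd.comp (measurable_snd.comp measurable_snd)))

/-- `P(main diagonal open) = 1/4 · 1/2`. [folklore] -/
theorem μIK_Dmain : μIK Dmain = 4⁻¹ * 2⁻¹ := by
  rw [μIK_eq, Measure.prod_apply_symm measurableSet_Dmain]
  simp only [slice_Dmain]
  rw [lintegral_indicator_const measurableSet_coin_not, ν_coin_not]

/-- `P(anti-diagonal open) = 1/4 · 1/2`. [folklore] -/
theorem μIK_Danti : μIK Danti = 4⁻¹ * 2⁻¹ := by
  rw [μIK_eq, Measure.prod_apply_symm measurableSet_Danti]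
  simp only [slice_Danti]
  rw [lintegral_indicator_const measurableSet_coin_mem, ν_coin_mem]

/-- One diagonal per face: the two diagonal bond events are disjoint. [folklore] -/
theorem Dmain_inter_Danti : Dmain ∩ Danti = ∅ := by
  ext ω; simp only [Dmain, Danti, Set.mem_inter_iff, Set.mem_setOf_eq, Set.mem_empty_iff_false, iff_false]
  tauto

/-- identification with the bond events of the crux's `edges` (for `0 ∈ S`) -/
theorem mainDiag_mem_edges_iff {S : Set ℤ} (hS : (0:ℤ) ∈ S) (ω : Ω) :
    s(![0, 0], ![1, 1]) ∈ edges S ω ↔ ω ∈ Dmain := by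
  simp only [edges, Dmain, Set.mem_setOf_eq]
  constructor
  · rintro ⟨u, v, huv, hu, hv, hrel⟩
    rw [Sym2.eq_iff] at huv
    rcases huv with ⟨rfl, rfl⟩ | ⟨rfl, rfl⟩
    · refine ⟨⟨(blk_zero_zero S ω).1 hu, (blk_one_one hS ω).1 hv⟩, ?_⟩
      rcases hrel with h | h | ⟨-, h⟩ | ⟨h, -⟩
      · exact absurd (congrFun h 1) (by simp)
      · exact absurd (congrFun h 0) (by simp)
      · simpa [antiSet, hS] using h
      · exact absurd (congrFun h 1) (by simp)
    · rcases hrel with h | h | ⟨h, -⟩ | ⟨h, -⟩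
      · exact absurd (congrFun h 0) (by simp)
      · exact absurd (congrFun h 1) (by simp)
      · exact absurd (congrFun h 0) (by simp)
      · exact absurd (congrFun h 0) (by simp)
  · rintro ⟨⟨h0, h1⟩, hc⟩
    exact ⟨![0, 0], ![1, 1], rfl, (blk_zero_zero S ω).2 h0, (blk_one_one hS ω).2 h1,
      Or.inr (Or.inr (Or.inl ⟨by ext i; fin_cases i <;> simp, by simpa [antiSet, hS] using hc⟩))⟩

/-- The anti-diagonal bond of the origin face is open iff `Danti` (for `0 ∈ S`). [folklore] -/
theorem antiDiag_mem_edges_iff {S : Set ℤ} (hS : (0:ℤ) ∈ S) (ω : Ω) :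
    s(![0, 1], ![1, 0]) ∈ edges S ω ↔ ω ∈ Danti := by
  simp only [edges, Danti, Set.mem_setOf_eq]
  constructor
  · rintro ⟨u, v, huv, hu, hv, hrel⟩
    rw [Sym2.eq_iff] at huv
    rcases huv with ⟨rfl, rfl⟩ | ⟨rfl, rfl⟩
    · refine ⟨⟨(blk_zero_one S ω).1 hu, (blk_one_zero S ω).1 hv⟩, ?_⟩
      rcases hrel with h | h | ⟨h, -⟩ | ⟨-, h⟩
      · exact absurd (congrFun h 1) (by simp)
      · exact absurd (congrFun h 0) (by simp)
      · exact absurd (congrFun h 1) (by simp)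
      · have : ![(0:ℤ), 1] + ![0, -1] = ![0, 0] := by ext i; fin_cases i <;> simp
        rw [this] at h
        simpa [antiSet, hS] using h
    · rcases hrel with h | h | ⟨h, -⟩ | ⟨h, -⟩
      · exact absurd (congrFun h 1) (by simp)
      · exact absurd (congrFun h 0) (by simp)
      · exact absurd (congrFun h 0) (by simp)
      · exact absurd (congrFun h 0) (by simp)
  · rintro ⟨⟨h0, h1⟩, hc⟩
    refine ⟨![0, 1], ![1, 0], rfl, (blk_zero_one S ω).2 h0, (blk_one_zero S ω).2 h1,
      Or.inr (Or.inr (Or.inr ⟨by ext i; fin_cases i <;> simp, ?_⟩))⟩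
    have : ![(0:ℤ), 1] + ![0, -1] = ![0, 0] := by ext i; fin_cases i <;> simp
    rw [this]
    simpa [antiSet, hS] using hc

/-- NO POSITIVE ASSOCIATION of the BOND field: in an `S`-column the two diagonal bonds of a face are
each open with probability `1/8` but never simultaneously (one diagonal per face), so the law of
`edges S ω` violates Harris–FKG for the increasing bond events `{main diagonal open}`,
`{anti-diagonal open}` — crossing events are increasing in exactly this structure. -/
theorem bondField_not_positivelyAssociated {S : Set ℤ} (hS : (0:ℤ) ∈ S) :
    μIK.real ({ω | s(![0, 0], ![1, 1]) ∈ edges S ω} ∩ {ω | s(![0, 1], ![1, 0]) ∈ edges S ω}) = 0 ∧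
    μIK.real {ω | s(![0, 0], ![1, 1]) ∈ edges S ω} = 1 / 8 ∧
    μIK.real {ω | s(![0, 1], ![1, 0]) ∈ edges S ω} = 1 / 8 := by
  have h1 : {ω | s(![0, 0], ![1, 1]) ∈ edges S ω} = Dmain := Set.ext (mainDiag_mem_edges_iff hS)
  have h2 : {ω | s(![0, 1], ![1, 0]) ∈ edges S ω} = Danti := Set.ext (antiDiag_mem_edges_iff hS)
  rw [h1, h2, Dmain_inter_Danti]
  refine ⟨by simp, ?_, ?_⟩
  · rw [Measure.real, μIK_Dmain, ENNReal.toReal_mul, ENNReal.toReal_inv, ENNReal.toReal_inv]; norm_num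
  · rw [Measure.real, μIK_Danti, ENNReal.toReal_mul, ENNReal.toReal_inv, ENNReal.toReal_inv]; norm_num


end

end Summit.CriticalPhenomena.CardyFormulaZ2.Theorems.IKMixedBoxCrossing.Negative
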